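import Summits.SmoothPoincare4.SmoothPoincare4.Theses.SymplecticOrigami
import Summits.SmoothPoincare4.SmoothPoincare4.Theorems.SymplecticOrigamiOrigamiFoldExistenceStubChartEmbedding
import Literature.Geometry.Symplectic.SphereProdSymplecticHost
import Literature.Geometry.Kaehler.ComplexProjectiveSpaceFubiniStudy
import Literature.Geometry.Manifold.OpenSubmanifoldMFDeriv
import Literature.Topology.FourManifolds.ComplexProjectiveSpaceProofs
import Literature.Topology.FourManifolds.HomotopySpheres
import Literature.Topology.FourManifolds.HomotopySpheresProofs
import Literature.Topology.FourManifolds.HomotopyS4OrientableProofs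
import Literature.Topology.FourManifolds.ConnectedSum
import Literature.Topology.FourManifolds.ConnectedSumExistence
import Literature.Topology.FourManifolds.UnorientedDiscTheorem
import Literature.Topology.FourManifolds.EquidimensionalEmbedding
import Literature.Topology.FourManifolds.GluckTwist
import Literature.Topology.FourManifolds.GluckTwistProofs
import Literature.Topology.FourManifolds.GluckTwistHomotopySphereProofs
import Literature.Barriers.SmoothPoincare4.GluckTwistsDissolveConnectedSumProofs
import Mathlib.Analysis.InnerProductSpace.Projection.FiniteDimensional

/-!
# Line `stable-seam-host` (crux `OrigamiFoldExistence`, stmt-SmoothPoincare4-7844), registry v2: STUB 1 IS PROVED FOR EVERY GLUCK TWIST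

Lead c10 certificate.  Registry v2 of the line widened the host notion of STUB 1
`stub_hostEmbedding` ("the fake ball `Δ_e = S ∖ e(B̊⁴)` of every homotopy 4-sphere embeds in a
closed simply connected symplectic rational host") from "square-zero symplectic sphere pair" to
"square-zero pair OR `(X, Ω) ≅ (ℂℙ², a·ω_FS)`" (`IsRationalHost`, Gromov's lines being the
uniruling).  With it, the line card's claim "STUB 1 is KNOWN for every Gluck twist" becomes a
kernel theorem:

* `helper_hostEmbedding_of_connectedSum_complexProjectivePlane` — `ℂℙ²`-DISSOLUTION ⇒ STUB 1 v2,
  pointwise: if some connected sum `P` of the homotopy 4-sphere `S` with the tree's `ℂℙ²`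
  (`Literature.Topology.FourManifolds.IsConnectedSum`) is diffeomorphic to `ℂℙ²` (`Φ`), then for
  EVERY chart ball `e` a neighbourhood of the fake ball embeds in the closed simply connected
  symplectic host `(P, Φ^* ω_FS)` (the tree's Fubini–Study form `CPn.fsForm 2`, symplectic by
  `CPn.isSmoothForm_fsForm` / `isClosedForm_fsForm` / `fsForm_nondegenerate`, transported by
  `isSymplectic_pullback_diffeomorph`), which is a rational host through the second disjunct with
  `Ψ = Φ`, `a = 1` (`MForm.pullback_apply`).  The embedding `J = j_A ∘ f` is built exactly as in
  the landed `StabOneSuffices` glue (p147741): `j_A` the gluing map of the punctured summand (an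
  equidimensional open smooth embedding, hence a local diffeomorphism), `f : S ≅ S` from the
  UNORIENTED DISC THEOREM carrying `e(B⁴)` onto the sum disc.
* `helper_hostEmbedding_of_isGluckTwist` — hence STUB 1 v2 holds for every homotopy 4-sphere whose
  carrier is a Gluck twist `Σ_K` of `S⁴` along a 2-knot `K`: connected sums `Σ_K # ℂℙ²` exist
  (`exists_isConnectedSum_holds`, Kervaire–Milnor) and are `ℂℙ²` by the tree's DISCHARGED
  dissolution theorem `gluckTwist_connectedSum_complexProjectivePlane_holds`
  (Gompf–Stipsicz Ex. 5.2.7(b); Kasprowski–Powell–Ray 2023 L. 3.1; Akbulut–Yasui 2013 Cor. 1.3).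
* `helper_gluckTwist_diffeomorph_sphere_of_stableSpheres` (rider) — THE GLUCK PROBLEM REDUCED TO
  STABLE 3-SPHERES IN RATIONAL SURFACES: the line's remaining stubs `stub_stableRepresentative`
  (SR: every embedded 3-sphere of a rational host is moved by a self-diffeomorphism to an Ω-stable
  one), the two formal transport stubs and `stub_stableSeamRigidity` (stable 3-spheres in rational
  hosts bound balls on their homologically trivial side) together imply that EVERY Gluck twist is
  diffeomorphic to `S⁴` (Kirby Problem 4.24 for Gluck twists) — with no dissolution hypothesis left.

No definitions, no named facts, no `sorry`.
-/

noncomputable section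

-- the prescribed namespace `Summit.<P>.<Sub>.…` duplicates `SmoothPoincare4` (P = Sub)
set_option linter.dupNamespace false

open scoped Manifold ContDiff Topology RealInnerProductSpace
open Set Function

namespace Summit.SmoothPoincare4.SmoothPoincare4.Theorems.OrigamiFoldExistence.StableSeamHost

open Literature.Geometry.Symplectic Literature.Geometry.Kaehler Literature.Topology.FourManifolds

/-- A linear automorphism of `ℝ⁴` with negative determinant preserving the norm: the orthogonal
reflection in a coordinate hyperplane (Mathlib's `Submodule.reflection`, `det = (-1)¹`).
[folklore] -/
private theorem exists_reflection_four' :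
    ∃ r : EuclideanSpace ℝ (Fin 4) ≃L[ℝ] EuclideanSpace ℝ (Fin 4),
      LinearMap.det (r.toLinearEquiv : EuclideanSpace ℝ (Fin 4) →ₗ[ℝ] EuclideanSpace ℝ (Fin 4)) < 0 ∧
        ∀ y, ‖r y‖ = ‖y‖ := by
  set v : EuclideanSpace ℝ (Fin 4) := EuclideanSpace.single 0 1 with hv
  have hv0 : v ≠ 0 := fun h => by
    have := congrArg (fun w : EuclideanSpace ℝ (Fin 4) => w 0) h
    simp [hv] at this
  set K : Submodule ℝ (EuclideanSpace ℝ (Fin 4)) := (ℝ ∙ v)ᗮ with hK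
  refine ⟨K.reflection.toContinuousLinearEquiv, ?_, fun y => K.reflection.norm_map y⟩
  have h1 : LinearMap.det ((K.reflection.toContinuousLinearEquiv).toLinearEquiv :
      EuclideanSpace ℝ (Fin 4) →ₗ[ℝ] EuclideanSpace ℝ (Fin 4)) =
        LinearMap.det K.reflection.toLinearMap := rfl
  rw [h1, Submodule.det_reflection, hK, Submodule.orthogonal_orthogonal, finrank_span_singleton hv0]
  norm_num

/-- **`ℂℙ²`-dissolution at `S` gives STUB 1 v2 at `S`**: if the punctured homotopy 4-sphere `S`
and the punctured `ℂℙ²` glue to an `ℝ⁴`-charted `P` (`IsConnectedSum`) diffeomorphic to `ℂℙ²`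
(`Φ`), then for every chart ball `e` a neighbourhood of the fake ball `S ∖ e(B̊⁴)` embeds into the
closed simply connected symplectic host `(P, Φ^* ω_FS)`, a rational host through the `ℂℙ²`
disjunct (`Ψ = Φ`, `a = 1`).  Unoriented disc theorem (Palais 1960 Thm. B / Hirsch 8.3.1, tree
theorem `exists_diffeomorph_apply_disc_eq_or_reflect_of_model`) to move `e(B⁴)` onto the sum
disc; the gluing map is an equidimensional open smooth embedding. [folklore] -/
theorem helper_hostEmbedding_of_connectedSum_complexProjectivePlane :
    ∀ (S : Literature.Topology.FourManifolds.HomotopySphere 4) (e : EuclideanSpace ℝ (Fin 4) → S.carrier), Manifold.IsSmoothEmbedding (𝓡 4) (𝓡 4) ∞ e → (∃ (P : Type) (_ : TopologicalSpace P) (_ : ChartedSpace (EuclideanSpace ℝ (Fin 4)) P) (_ : IsManifold (𝓡 4) ∞ P), Literature.Topology.FourManifolds.IsConnectedSum (𝓡 4) (𝓡 4) (𝓡 4) S.carrier Literature.Topology.FourManifolds.ComplexProjectivePlane P ∧ Nonempty (P ≃ₘ⟮𝓡 4, 𝓡 4⟯ Literature.Topology.FourManifolds.ComplexProjectivePlane))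 → ∃ (X : Type) (_ : TopologicalSpace X) (_ : T2Space X) (_ : SecondCountableTopology X) (_ : CompactSpace X) (_ : ChartedSpace (EuclideanSpace ℝ (Fin 4)) X) (_ : IsManifold (𝓡 4) ∞ X) (_ : SimplyConnectedSpace X) (Ω : Literature.Geometry.Kaehler.MForm (𝓡 4) X ℝ 2) (J : S.carrier → X), (Literature.Geometry.Kaehler.IsSmoothForm Ω ∧ Literature.Geometry.Kaehler.IsClosedForm Ω ∧ ∀ x (v : TangentSpace (𝓡 4) x), v ≠ 0 → ∃ w, Ω x ![v, w] ≠ 0) ∧ (∃ U : Set S.carrier, IsOpen U ∧ (e '' Metric.ball (0 : EuclideanSpace ℝ (Fin 4)) 1)ᶜ ⊆ U ∧ ContMDiffOn (𝓡 4) (𝓡 4) ∞ J U ∧ Set.InjOn J U ∧ ∀ x ∈ U, Function.Bijective (mfderiv (𝓡 4) (𝓡 4) J x)) ∧ ((∃ c c' : (Metric.sphere (0 : EuclideanSpace ℝ (Fin 3)) 1) → X, (Manifold.IsSmoothEmbedding (𝓡 2) (𝓡 4) ∞ c ∧ (∀ y (v : TangentSpace (𝓡 2) y), v ≠ 0 →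 ∃ w : TangentSpace (𝓡 2) y, Ω (c y) ![mfderiv (𝓡 2) (𝓡 4) c y v, mfderiv (𝓡 2) (𝓡 4) c y w] ≠ 0) ∧ Manifold.IsSmoothEmbedding (𝓡 2) (𝓡 4) ∞ c' ∧ Disjoint (Set.range c) (Set.range c') ∧ ∃ H : unitInterval × (Metric.sphere (0 : EuclideanSpace ℝ (Fin 3)) 1) → X, Continuous H ∧ ∀ y, H (0, y) = c y ∧ H (1, y) = c' y)) ∨ (∃ (Ψ : X ≃ₘ⟮𝓡 4, 𝓡 4⟯ Literature.Topology.FourManifolds.ComplexProjectivePlane) (a : ℝ), 0 < a ∧ ∀ x (v w : TangentSpace (𝓡 4) x), Ω x ![v, w] = a * Literature.Geometry.Kaehler.CPn.fsForm 2 (Ψ x) ![mfderiv (𝓡 4) (𝓡 4) Ψ x v, mfderiv (𝓡 4) (𝓡 4) Ψ x w])) := by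
  intro S e he hDis
  obtain ⟨P, _, _, _, hCS, ⟨Φ⟩⟩ := hDis
  -- point-set instances on `P`, transported from `ℂℙ²` along `Φ`
  let eP : P ≃ₜ ComplexProjectivePlane := Φ.toHomeomorph
  haveI : T2Space P := eP.symm.t2Space
  haveI : SecondCountableTopology P := eP.secondCountableTopology
  haveI : CompactSpace P := eP.symm.compactSpace
  haveI : SimplyConnectedSpace ComplexProjectivePlane :=
    simplyConnectedSpace_complexProjectivePlane_holds
  haveI : SimplyConnectedSpace P := eP.toHomotopyEquiv.simplyConnectedSpace
  -- the host form `Φ^* ω_FS` is symplectic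
  have hΩ := isSymplectic_pullback_diffeomorph (I := 𝓡 4) (J := 𝓡 4) Φ
    (s := (CPn.fsForm 2 : MForm (𝓡 4) ComplexProjectivePlane ℝ 2))
    ⟨CPn.isSmoothForm_fsForm, CPn.isClosedForm_fsForm, CPn.fsForm_nondegenerate⟩
  -- the connected-sum data: discs `i₁ : ℝ⁴ ↪ S`, `i₂`, and the gluing map `jA` of `S ∖ {i₁ 0}`
  obtain ⟨i₁, i₂, hi₁, -, jA, jB, hjA, hjAo, -, -, -, -⟩ := hCS
  -- `jA` is a local diffeomorphism (equidimensional open smooth embedding)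
  have hloc : IsLocalDiffeomorph (𝓡 4) (𝓡 4) ∞ jA :=
    hjA.isLocalDiffeomorph_of_finrank_eq rfl
  -- the total extension `J₀ : S → P` of `jA`
  obtain ⟨u, hu⟩ : ∃ u : EuclideanSpace ℝ (Fin 4), u ≠ 0 := exists_ne 0
  have hu1 : i₁ u ∈ (puncture i₁ : Set S.carrier) := fun h => hu (hi₁.isEmbedding.injective h)
  set J₀ : S.carrier → P := Subtype.val.extend jA (fun _ => jA ⟨i₁ u, hu1⟩) with hJ₀
  have hJ₀val : ∀ x : ↥(puncture i₁), J₀ x = jA x := fun x =>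
    Subtype.val_injective.extend_apply _ _ x
  have hJ₀fun : (fun x : ↥(puncture i₁) => J₀ x) = jA := funext hJ₀val
  have hJ₀s : ContMDiffOn (𝓡 4) (𝓡 4) ∞ J₀ (puncture i₁ : Set S.carrier) := fun x hx =>
    (contMDiffAt_subtype_iff.1 (by rw [hJ₀fun]; exact hjA.contMDiff ⟨x, hx⟩)).contMDiffWithinAt
  have hJ₀i : InjOn J₀ (puncture i₁ : Set S.carrier) := fun x hx y hy hxy => by
    have h := hjA.isEmbedding.injective (a₁ := ⟨x, hx⟩) (a₂ := ⟨y, hy⟩)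
      (by rw [← hJ₀val, ← hJ₀val]; exact hxy)
    exact congrArg Subtype.val h
  have hJ₀d : ∀ x (hx : x ∈ (puncture i₁ : Set S.carrier)),
      Bijective (mfderiv (𝓡 4) (𝓡 4) J₀ x) := by
    intro x hx
    have hxd : MDifferentiableAt (𝓡 4) (𝓡 4) J₀ x :=
      ((hJ₀s x hx).contMDiffAt ((puncture i₁).isOpen.mem_nhds hx)).mdifferentiableAt (by simp)
    have hvd : MDifferentiableAt (𝓡 4) (𝓡 4) (Subtype.val : ↥(puncture i₁) → S.carrier) ⟨x, hx⟩ :=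
      (contMDiff_subtype_val (n := ∞)).mdifferentiableAt (by simp)
    have e1 := mfderiv_comp (⟨x, hx⟩ : ↥(puncture i₁)) hxd hvd
    have hcomp : J₀ ∘ (Subtype.val : ↥(puncture i₁) → S.carrier) = jA := hJ₀fun
    rw [hcomp, Literature.Geometry.Manifold.OpenSubmanifold.mfderiv_subtype_val] at e1
    have hb := ((hloc ⟨x, hx⟩).mfderivToContinuousLinearEquiv (by simp)).bijective
    have hfun : ⇑(mfderiv (𝓡 4) (𝓡 4) jA ⟨x, hx⟩) = ⇑(mfderiv (𝓡 4) (𝓡 4) J₀ x) := by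
      funext v
      rw [e1]
      rfl
    exact hfun ▸ hb
  -- unoriented disc theorem: move the chart disc onto the sum disc
  haveI : ConnectedSpace S.carrier := HomotopySphere.connectedSpace (by norm_num) S
  obtain ⟨r, hr, hrn⟩ := exists_reflection_four'
  obtain ⟨f, hf⟩ := exists_diffeomorph_apply_disc_eq_or_reflect_of_model (I := 𝓡 4)
    (by simp) he hi₁ r hr
  have hfe : ∀ x, x ∉ e '' Metric.ball (0 : EuclideanSpace ℝ (Fin 4)) 1 →
      f x ∉ i₁ '' Metric.ball (0 : EuclideanSpace ℝ (Fin 4)) 1 := by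
    rintro x hx ⟨z, hz, hzx⟩
    have hz1 : ‖z‖ ≤ 1 := (mem_ball_zero_iff.1 hz).le
    rcases hf with hf | hf
    · have h1 : f (e z) = f x := (hf z hz1).trans hzx
      exact hx ⟨z, hz, EquivLike.injective f h1⟩
    · have h1 : f (e (r z)) = f x := (hf z hz1).trans hzx
      refine hx ⟨r z, ?_, EquivLike.injective f h1⟩
      rw [mem_ball_zero_iff, hrn]
      exact mem_ball_zero_iff.1 hz
  -- the open set `U = f⁻¹(S ∖ i₁(½B⁴))`
  set D : Set S.carrier := i₁ '' Metric.closedBall (0 : EuclideanSpace ℝ (Fin 4)) 2⁻¹ with hD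
  have hDc : IsClosed D :=
    ((isCompact_closedBall _ _).image hi₁.contMDiff.continuous).isClosed
  have hDp : Dᶜ ⊆ (puncture i₁ : Set S.carrier) := fun x hx h0 =>
    hx ⟨0, Metric.mem_closedBall_self (by norm_num), h0.symm⟩
  have hfd : MDifferentiable (𝓡 4) (𝓡 4) f := f.mdifferentiable (by simp)
  refine ⟨P, inferInstance, inferInstance, inferInstance, inferInstance, inferInstance,
    inferInstance, inferInstance, (CPn.fsForm 2 : MForm (𝓡 4) ComplexProjectivePlane ℝ 2).pullback (𝓡 4) Φ,
    J₀ ∘ f, hΩ, ⟨f ⁻¹' Dᶜ, hDc.isOpen_compl.preimage f.continuous, ?_, ?_, ?_, ?_⟩,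
    Or.inr ⟨Φ, 1, one_pos, fun x v w => ?_⟩⟩
  · -- the fake ball lies in `U`
    intro x hx hxD
    obtain ⟨z, hz, hzx⟩ := hxD
    exact hfe x hx ⟨z, Metric.closedBall_subset_ball (by norm_num) hz, hzx⟩
  · -- smoothness
    exact hJ₀s.comp f.contMDiff.contMDiffOn fun x hx => hDp hx
  · -- injectivity
    intro x hx y hy hxy
    exact EquivLike.injective f (hJ₀i (hDp hx) (hDp hy) hxy)
  · -- bijective differential
    intro x hx
    have hx' : f x ∈ (puncture i₁ : Set S.carrier) := hDp hx
    rw [mfderiv_comp x (((hJ₀s _ hx').contMDiffAt ((puncture i₁).isOpen.mem_nhds hx')).mdifferentiableAt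
      (by simp)) (hfd x)]
    exact (hJ₀d _ hx').comp (bijective_mfderiv_diffeomorph f x)
  · -- the `ℂℙ²` disjunct of the rational host: `Φ^* ω_FS = 1 · ω_FS(dΦ ·, dΦ ·)`
    rw [MForm.pullback_apply, one_mul]
    congr 1
    funext i
    fin_cases i <;> rfl

/-- **STUB 1 v2 holds for every Gluck twist.**  For a homotopy 4-sphere `S` whose carrier is a
Gluck twist `Σ_K` of `S⁴` along the 2-knot `K` (`IsGluckTwist`), and every chart ball `e`, a
neighbourhood of the fake ball embeds in a closed simply connected symplectic rational host: a
connected sum `Σ_K # ℂℙ²` exists (Kervaire–Milnor 1963 §2, tree theorem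
`exists_isConnectedSum_holds`) and is diffeomorphic to `ℂℙ²` by the tree's discharged dissolution
theorem `gluckTwist_connectedSum_complexProjectivePlane_holds` (Gompf–Stipsicz 1999 Ex. 5.2.7(b);
Kasprowski–Powell–Ray 2023, Lemma 3.1; Akbulut–Yasui 2013, Cor. 1.3); conclude by
`helper_hostEmbedding_of_connectedSum_complexProjectivePlane`.
[cite: KasprowskiPowellRay2023, Lemma 3.1] -/
theorem helper_hostEmbedding_of_isGluckTwist :
    ∀ (K : Literature.Topology.FourManifolds.TwoKnot) (S : Literature.Topology.FourManifolds.HomotopySphere 4) (e : EuclideanSpace ℝ (Fin 4) → S.carrier), Literature.Topology.FourManifolds.IsGluckTwist (𝓡 4) S.carrier K → Manifold.IsSmoothEmbedding (𝓡 4) (𝓡 4) ∞ e → ∃ (X : Type) (_ : TopologicalSpace X) (_ : T2Space X) (_ : SecondCountableTopology X) (_ : CompactSpace X) (_ : ChartedSpace (EuclideanSpace ℝ (Fin 4)) X) (_ : IsManifold (𝓡 4) ∞ X) (_ : SimplyConnectedSpace X) (Ω : Literature.Geometry.Kaehler.MForm (𝓡 4) X ℝ 2) (J : S.carrier → X), (Literature.Geometry.Kaehler.IsSmoothForm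 Ω ∧ Literature.Geometry.Kaehler.IsClosedForm Ω ∧ ∀ x (v : TangentSpace (𝓡 4) x), v ≠ 0 → ∃ w, Ω x ![v, w] ≠ 0) ∧ (∃ U : Set S.carrier, IsOpen U ∧ (e '' Metric.ball (0 : EuclideanSpace ℝ (Fin 4)) 1)ᶜ ⊆ U ∧ ContMDiffOn (𝓡 4) (𝓡 4) ∞ J U ∧ Set.InjOn J U ∧ ∀ x ∈ U, Function.Bijective (mfderiv (𝓡 4) (𝓡 4) J x)) ∧ ((∃ c c' : (Metric.sphere (0 : EuclideanSpace ℝ (Fin 3)) 1) → X, (Manifold.IsSmoothEmbedding (𝓡 2) (𝓡 4) ∞ c ∧ (∀ y (v : TangentSpace (𝓡 2) y), v ≠ 0 → ∃ w : TangentSpace (𝓡 2) y, Ω (c y) ![mfderiv (𝓡 2) (𝓡 4) c y v, mfderiv (𝓡 2) (𝓡 4) c y w] ≠ 0) ∧ Manifold.IsSmoothEmbedding (𝓡 2) (𝓡 4) ∞ c' ∧ Disjoint (Set.range c) (Set.range c') ∧ ∃ H : unitInterval × (Metric.sphere (0 : EuclideanSpace ℝ (Fin 3)) 1) → X, Continuous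 H ∧ ∀ y, H (0, y) = c y ∧ H (1, y) = c' y)) ∨ (∃ (Ψ : X ≃ₘ⟮𝓡 4, 𝓡 4⟯ Literature.Topology.FourManifolds.ComplexProjectivePlane) (a : ℝ), 0 < a ∧ ∀ x (v w : TangentSpace (𝓡 4) x), Ω x ![v, w] = a * Literature.Geometry.Kaehler.CPn.fsForm 2 (Ψ x) ![mfderiv (𝓡 4) (𝓡 4) Ψ x v, mfderiv (𝓡 4) (𝓡 4) Ψ x w])) := by
  intro K S e hK he
  haveI : Nonempty S.carrier := ⟨e 0⟩
  obtain ⟨P, _, _, _, _, _, _, hCS⟩ :=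
    exists_isConnectedSum_holds (n := 4) S.carrier ComplexProjectivePlane
  exact helper_hostEmbedding_of_connectedSum_complexProjectivePlane S e he
    ⟨P, inferInstance, inferInstance, inferInstance, hCS,
      Literature.Barriers.SmoothPoincare4.gluckTwist_connectedSum_complexProjectivePlane_holds
        K S.carrier hK P hCS⟩

/-- **The Gluck problem reduced to stable 3-spheres in rational surfaces** (rider of the line's
registry v2).  If (SR) every shell-embedded 3-sphere of a closed simply connected symplectic
rational host is moved by a self-diffeomorphism to an Ω-stable one, if (transport) fake-ball-
neighbourhood embeddings survive post-composition with diffeomorphisms and their seams are shell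
embeddings, and if (STUB 3) a homotopy 4-sphere whose fake ball sits in a rational host with
Ω-stable seam is `S⁴`, then EVERY Gluck twist `Σ_K` is diffeomorphic to `S⁴`: `Σ_K` is compact
(`IsGluckTwist.compactSpace_holds`), homotopy equivalent to `S⁴` (Gluck 1962 §17, tree theorem
`IsGluckTwist.nonempty_homotopyEquiv_sphere`), orientable
(`isOrientable_of_homotopyEquiv_sphere_four_holds`), hence a `HomotopySphere 4`; take a chart ball
(`stub_chartEmbedding`, p87331), the Gluck-twist host (`helper_hostEmbedding_of_isGluckTwist`),
and run SR ⟶ transport ⟶ rigidity. [cite: GluckTAMS1962, §17] -/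
theorem helper_gluckTwist_diffeomorph_sphere_of_stableSpheres :
    (∀ (X : Type) [TopologicalSpace X] [T2Space X] [SecondCountableTopology X] [CompactSpace X] [ChartedSpace (EuclideanSpace ℝ (Fin 4)) X] [IsManifold (𝓡 4) ∞ X] [SimplyConnectedSpace X] (Ω : Literature.Geometry.Kaehler.MForm (𝓡 4) X ℝ 2) (g : EuclideanSpace ℝ (Fin 4) → X), (Literature.Geometry.Kaehler.IsSmoothForm Ω ∧ Literature.Geometry.Kaehler.IsClosedForm Ω ∧ ∀ x (v : TangentSpace (𝓡 4) x), v ≠ 0 → ∃ w, Ω x ![v, w] ≠ 0) → ((∃ c c' : (Metric.sphere (0 : EuclideanSpace ℝ (Fin 3)) 1) → X, (Manifold.IsSmoothEmbedding (𝓡 2) (𝓡 4) ∞ c ∧ (∀ y (v : TangentSpace (𝓡 2) y), v ≠ 0 → ∃ w : TangentSpace (𝓡 2) y, Ω (c y) ![mfderiv (𝓡 2) (𝓡 4) c y v, mfderiv (𝓡 2) (𝓡 4) c y w] ≠ 0) ∧ Manifold.IsSmoothEmbedding (𝓡 2) (𝓡 4) ∞ c' ∧ Disjoint (Set.range c) (Set.range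 c') ∧ ∃ H : unitInterval × (Metric.sphere (0 : EuclideanSpace ℝ (Fin 3)) 1) → X, Continuous H ∧ ∀ y, H (0, y) = c y ∧ H (1, y) = c' y)) ∨ (∃ (Ψ : X ≃ₘ⟮𝓡 4, 𝓡 4⟯ Literature.Topology.FourManifolds.ComplexProjectivePlane) (a : ℝ), 0 < a ∧ ∀ x (v w : TangentSpace (𝓡 4) x), Ω x ![v, w] = a * Literature.Geometry.Kaehler.CPn.fsForm 2 (Ψ x) ![mfderiv (𝓡 4) (𝓡 4) Ψ x v, mfderiv (𝓡 4) (𝓡 4) Ψ x w])) → (∃ V : Set (EuclideanSpace ℝ (Fin 4)), IsOpen V ∧ Metric.sphere (0 : EuclideanSpace ℝ (Fin 4)) 1 ⊆ V ∧ ContMDiffOn (𝓡 4) (𝓡 4) ∞ g V ∧ Set.InjOn g V ∧ ∀ u ∈ V, Function.Bijective (mfderiv (𝓡 4) (𝓡 4) g u)) → ∃ (φ : X ≃ₘ⟮𝓡 4, 𝓡 4⟯ X) (θ : EuclideanSpace ℝ (Fin 4) → EuclideanSpace ℝ (Fin 4) →L[ℝ] ℝ), (ContDiff ℝ ∞ θ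 ∧ (∀ u : EuclideanSpace ℝ (Fin 4), ‖u‖ = 1 → ∀ v : Fin 3 → EuclideanSpace ℝ (Fin 4), (∀ i, ⟪v i, u⟫ = 0) → LinearIndependent ℝ v → θ u (v 0) * Ω ((φ ∘ g) u) ![mfderiv (𝓡 4) (𝓡 4) (φ ∘ g) u (v 1), mfderiv (𝓡 4) (𝓡 4) (φ ∘ g) u (v 2)] - θ u (v 1) * Ω ((φ ∘ g) u) ![mfderiv (𝓡 4) (𝓡 4) (φ ∘ g) u (v 0), mfderiv (𝓡 4) (𝓡 4) (φ ∘ g) u (v 2)] + θ u (v 2) * Ω ((φ ∘ g) u) ![mfderiv (𝓡 4) (𝓡 4) (φ ∘ g) u (v 0), mfderiv (𝓡 4) (𝓡 4) (φ ∘ g) u (v 1)] ≠ 0) ∧ (∀ u : EuclideanSpace ℝ (Fin 4), ‖u‖ = 1 → ∀ v : EuclideanSpace ℝ (Fin 4), ⟪v, u⟫ = 0 → (∀ w : EuclideanSpace ℝ (Fin 4), ⟪w, u⟫ = 0 → Ω ((φ ∘ g) u) ![mfderiv (𝓡 4) (𝓡 4) (φ ∘ g) u v, mfderiv (𝓡 4)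 (𝓡 4) (φ ∘ g) u w] = 0) → ∀ w : EuclideanSpace ℝ (Fin 4), ⟪w, u⟫ = 0 → fderiv ℝ θ u v w - fderiv ℝ θ u w v = 0))) → (∀ (S : Literature.Topology.FourManifolds.HomotopySphere 4) (e : EuclideanSpace ℝ (Fin 4) → S.carrier) (X : Type) [TopologicalSpace X] [ChartedSpace (EuclideanSpace ℝ (Fin 4)) X] [IsManifold (𝓡 4) ∞ X] (Y : Type) [TopologicalSpace Y] [ChartedSpace (EuclideanSpace ℝ (Fin 4)) Y] [IsManifold (𝓡 4) ∞ Y] (J : S.carrier → X) (φ : X ≃ₘ⟮𝓡 4, 𝓡 4⟯ Y), (∃ U : Set S.carrier, IsOpen U ∧ (e '' Metric.ball (0 : EuclideanSpace ℝ (Fin 4)) 1)ᶜ ⊆ U ∧ ContMDiffOn (𝓡 4) (𝓡 4) ∞ J U ∧ Set.InjOn J U ∧ ∀ x ∈ U, Function.Bijective (mfderiv (𝓡 4) (𝓡 4) J x)) → (∃ U : Set S.carrier, IsOpen U ∧ (e '' Metric.ball (0 : EuclideanSpace ℝ (Fin 4)) 1)ᶜ ⊆ U ∧ ContMDiffOn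 (𝓡 4) (𝓡 4) ∞ (φ ∘ J) U ∧ Set.InjOn (φ ∘ J) U ∧ ∀ x ∈ U, Function.Bijective (mfderiv (𝓡 4) (𝓡 4) (φ ∘ J) x))) → (∀ (S : Literature.Topology.FourManifolds.HomotopySphere 4) (e : EuclideanSpace ℝ (Fin 4) → S.carrier) (X : Type) [TopologicalSpace X] [ChartedSpace (EuclideanSpace ℝ (Fin 4)) X] [IsManifold (𝓡 4) ∞ X] (J : S.carrier → X), Manifold.IsSmoothEmbedding (𝓡 4) (𝓡 4) ∞ e → (∃ U : Set S.carrier, IsOpen U ∧ (e '' Metric.ball (0 : EuclideanSpace ℝ (Fin 4)) 1)ᶜ ⊆ U ∧ ContMDiffOn (𝓡 4) (𝓡 4) ∞ J U ∧ Set.InjOn J U ∧ ∀ x ∈ U, Function.Bijective (mfderiv (𝓡 4) (𝓡 4) J x)) → (∃ V : Set (EuclideanSpace ℝ (Fin 4)), IsOpen V ∧ Metric.sphere (0 : EuclideanSpace ℝ (Fin 4)) 1 ⊆ V ∧ ContMDiffOn (𝓡 4) (𝓡 4) ∞ (J ∘ e) V ∧ Set.InjOn (J ∘ e) V ∧ ∀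 u ∈ V, Function.Bijective (mfderiv (𝓡 4) (𝓡 4) (J ∘ e) u))) → (∀ (S : Literature.Topology.FourManifolds.HomotopySphere 4) (e : EuclideanSpace ℝ (Fin 4) → S.carrier) (X : Type) [TopologicalSpace X] [T2Space X] [SecondCountableTopology X] [CompactSpace X] [ChartedSpace (EuclideanSpace ℝ (Fin 4)) X] [IsManifold (𝓡 4) ∞ X] [SimplyConnectedSpace X] (Ω : Literature.Geometry.Kaehler.MForm (𝓡 4) X ℝ 2) (J : S.carrier → X) (θ : EuclideanSpace ℝ (Fin 4) → EuclideanSpace ℝ (Fin 4) →L[ℝ] ℝ), Manifold.IsSmoothEmbedding (𝓡 4) (𝓡 4) ∞ e → (Literature.Geometry.Kaehler.IsSmoothForm Ω ∧ Literature.Geometry.Kaehler.IsClosedForm Ω ∧ ∀ x (v : TangentSpace (𝓡 4) x), v ≠ 0 → ∃ w, Ω x ![v, w] ≠ 0) → (∃ U : Set S.carrier, IsOpen U ∧ (e '' Metric.ball (0 : EuclideanSpace ℝ (Fin 4)) 1)ᶜ ⊆ U ∧ ContMDiffOn (𝓡 4) (𝓡 4) ∞ J U ∧ Set.InjOn J U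 ∧ ∀ x ∈ U, Function.Bijective (mfderiv (𝓡 4) (𝓡 4) J x)) → ((∃ c c' : (Metric.sphere (0 : EuclideanSpace ℝ (Fin 3)) 1) → X, (Manifold.IsSmoothEmbedding (𝓡 2) (𝓡 4) ∞ c ∧ (∀ y (v : TangentSpace (𝓡 2) y), v ≠ 0 → ∃ w : TangentSpace (𝓡 2) y, Ω (c y) ![mfderiv (𝓡 2) (𝓡 4) c y v, mfderiv (𝓡 2) (𝓡 4) c y w] ≠ 0) ∧ Manifold.IsSmoothEmbedding (𝓡 2) (𝓡 4) ∞ c' ∧ Disjoint (Set.range c) (Set.range c') ∧ ∃ H : unitInterval × (Metric.sphere (0 : EuclideanSpace ℝ (Fin 3)) 1) → X, Continuous H ∧ ∀ y, H (0, y) = c y ∧ H (1, y) = c' y)) ∨ (∃ (Ψ : X ≃ₘ⟮𝓡 4, 𝓡 4⟯ Literature.Topology.FourManifolds.ComplexProjectivePlane) (a : ℝ), 0 < a ∧ ∀ x (v w : TangentSpace (𝓡 4) x), Ω x ![v, w] = a * Literature.Geometry.Kaehler.CPn.fsForm 2 (Ψ x) ![mfderiv (𝓡 4) (𝓡 4)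 Ψ x v, mfderiv (𝓡 4) (𝓡 4) Ψ x w])) → (ContDiff ℝ ∞ θ ∧ (∀ u : EuclideanSpace ℝ (Fin 4), ‖u‖ = 1 → ∀ v : Fin 3 → EuclideanSpace ℝ (Fin 4), (∀ i, ⟪v i, u⟫ = 0) → LinearIndependent ℝ v → θ u (v 0) * Ω ((J ∘ e) u) ![mfderiv (𝓡 4) (𝓡 4) (J ∘ e) u (v 1), mfderiv (𝓡 4) (𝓡 4) (J ∘ e) u (v 2)] - θ u (v 1) * Ω ((J ∘ e) u) ![mfderiv (𝓡 4) (𝓡 4) (J ∘ e) u (v 0), mfderiv (𝓡 4) (𝓡 4) (J ∘ e) u (v 2)] + θ u (v 2) * Ω ((J ∘ e) u) ![mfderiv (𝓡 4) (𝓡 4) (J ∘ e) u (v 0), mfderiv (𝓡 4) (𝓡 4) (J ∘ e) u (v 1)] ≠ 0) ∧ (∀ u : EuclideanSpace ℝ (Fin 4), ‖u‖ = 1 → ∀ v : EuclideanSpace ℝ (Fin 4), ⟪v, u⟫ = 0 → (∀ w : EuclideanSpace ℝ (Fin 4), ⟪w, u⟫ = 0 → Ω ((J ∘ e) u) ![mfderiv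 (𝓡 4) (𝓡 4) (J ∘ e) u v, mfderiv (𝓡 4) (𝓡 4) (J ∘ e) u w] = 0) → ∀ w : EuclideanSpace ℝ (Fin 4), ⟪w, u⟫ = 0 → fderiv ℝ θ u v w - fderiv ℝ θ u w v = 0)) → Nonempty (S.carrier ≃ₘ⟮𝓡 4, 𝓡 4⟯ Metric.sphere (0 : EuclideanSpace ℝ (Fin 5)) 1)) → ∀ (K : Literature.Topology.FourManifolds.TwoKnot) (X : Type) [TopologicalSpace X] [T2Space X] [SecondCountableTopology X] [ChartedSpace (EuclideanSpace ℝ (Fin 4)) X] [IsManifold (𝓡 4) ∞ X], Literature.Topology.FourManifolds.IsGluckTwist (𝓡 4) X K → Nonempty (X ≃ₘ⟮𝓡 4, 𝓡 4⟯ Metric.sphere (0 : EuclideanSpace ℝ (Fin 5)) 1) := by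
  intro hSR hT hSh h3 K X _ _ _ _ _ hX
  haveI : CompactSpace X := IsGluckTwist.compactSpace_holds hX
  obtain ⟨g⟩ := hX.nonempty_homotopyEquiv_sphere
  obtain ⟨o⟩ := isOrientable_of_homotopyEquiv_sphere_four_holds X g
  let S : HomotopySphere 4 := ⟨X, o, ⟨g⟩⟩
  obtain ⟨e, he⟩ :=
    Summit.SmoothPoincare4.SmoothPoincare4.Theorems.OrigamiFoldExistence.RoundTraceContinuity.stub_chartEmbedding S
  obtain ⟨Y, _, _, _, _, _, _, _, Ω, J, hΩ, hJ, hY⟩ := helper_hostEmbedding_of_isGluckTwist K S e hX he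
  obtain ⟨φ, θ, hθ⟩ := hSR Y Ω (J ∘ e) hΩ hY (hSh S e Y J he hJ)
  exact h3 S e Y Ω (φ ∘ J) θ he hΩ (hT S e Y Y J φ hJ) hY hθ

end Summit.SmoothPoincare4.SmoothPoincare4.Theorems.OrigamiFoldExistence.StableSeamHost

end
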